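import Mathlib
import Literature.NumberTheory.Automorphic.AutomorphicGLn

/-!
# `flath_exists` as stated is false: the `def` dropped its locally-profinite instance binders

`Literature.NumberTheory.Automorphic.flath_exists` is declared in a section with instance variables
`[∀ i, NonarchimedeanGroup (G i)] [∀ i, LocallyCompactSpace (G i)] [∀ i, T2Space (G i)]`, but a
`def` only keeps the section variables its body mentions, so the constant actually has type
`{ι} → [DecidableEq ι] → {G : ι → Type v} → [∀ i, Group (G i)] → [∀ i, TopologicalSpace (G i)] →
 {K : ∀ i, Subgroup (G i)} → {W : Type w} → [AddCommGroup W] → [Module ℂ W] → Prop`: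
its universal closure quantifies over families of groups carrying *arbitrary* topologies (not even
`IsTopologicalGroup`). We refute that closure (at universe level `0`) with `ι = Bool`,
`G true = G₁` = Laurent series over `ℂ` with leading coefficient `1` (discrete topology, `K = ⊥`),
`G false = G₂ = ℤ` with the (non-group) topology generated by the sets
`C k = {n even | -2k ≤ n}` (`K = ⊤`, compact because every open set containing an odd integer is
everything), `W = ℂ((X))` and `π (u, n) f = (-1)ⁿ u f`.

Classification: refuted-misstated. Repaired statement `C′`: move the mixins into the body,
`∀ [∀ i, IsTopologicalGroup (G i)], …` (or the full locally-profinite triple, as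
`IsRestrictedTensorProductRep.isIrreducible` does); the witness below is not a topological group,
so it does not bite `C′`.
-/

noncomputable section

open scoped RestrictedProduct
open Filter Topology

namespace Literature.NumberTheory.Automorphic

namespace FlathCex

/-! ## The field `F = ℂ((X))` and the group `G₁` -/

/-- The field `F = ℂ((X))` of Laurent series over `ℂ` (Mathlib `LaurentSeries ℂ = HahnSeries ℤ ℂ`), carrying its coefficientwise `ℂ`-module structure. [folklore] -/
abbrev F : Type := LaurentSeries ℂ


/-- Units of `ℂ((X))` with leading coefficient `1`. [folklore] -/
def Gker : Subgroup Fˣ where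
  carrier := {u | (u : F).leadingCoeff = 1}
  mul_mem' := by
    intro a b ha hb
    simp only [Set.mem_setOf_eq, Units.val_mul, HahnSeries.leadingCoeff_mul] at *
    rw [ha, hb, one_mul]
  one_mem' := by simp
  inv_mem' := by
    intro a ha
    simp only [Set.mem_setOf_eq] at *
    have h := congrArg HahnSeries.leadingCoeff a.mul_inv
    rw [HahnSeries.leadingCoeff_mul, ha, one_mul, HahnSeries.leadingCoeff_one] at h
    exact h

/-- `G₁`, a type synonym (so that it carries the *discrete* topology and nothing else). [folklore] -/
def G₁ : Type := ↥Gker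

/-- The group structure on `G₁`, inherited from the subgroup `Gker ≤ Fˣ`. [folklore] -/
instance : Group G₁ := inferInstanceAs (Group ↥Gker)
/-- The discrete topology on `G₁`. [folklore] -/
instance instTopG₁ : TopologicalSpace G₁ := ⊥
/-- `G₁` is discrete. [folklore] -/
instance : DiscreteTopology G₁ := ⟨rfl⟩

/-- The underlying Laurent series of `u : G₁`. [folklore] -/
def G₁.val (u : G₁) : F := ((show ↥Gker from u) : Fˣ)

/-- `G₁.val` is multiplicative. [folklore] -/
@[simp] lemma G₁.val_mul (u v : G₁) : (u * v).val = u.val * v.val := rfl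
/-- `G₁.val 1 = 1`. [folklore] -/
@[simp] lemma G₁.val_one : (1 : G₁).val = 1 := rfl
/-- Elements of `G₁` have leading coefficient `1`. [folklore] -/
lemma G₁.leadingCoeff_val (u : G₁) : u.val.leadingCoeff = 1 := (show ↥Gker from u).2
/-- Elements of `G₁` are non-zero Laurent series. [folklore] -/
lemma G₁.val_ne_zero (u : G₁) : u.val ≠ 0 := ((show ↥Gker from u) : Fˣ).ne_zero
/-- `G₁.val` is injective. [folklore] -/
lemma G₁.val_injective : Function.Injective G₁.val := fun _ _ h => Subtype.ext (Units.ext h)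
/-- `u.val = 1 ↔ u = 1`. [folklore] -/
lemma G₁.val_eq_one {u : G₁} : u.val = 1 ↔ u = 1 := by
  rw [← G₁.val_one]; exact G₁.val_injective.eq_iff

/-- A Laurent series with leading coefficient `1`, as an element of `G₁`. [folklore] -/
def G₁.mk (f : F) (hf : f.leadingCoeff = 1) : G₁ :=
  (⟨Units.mk0 f (by rintro rfl; simp at hf), hf⟩ : ↥Gker)

/-- `G₁.val (G₁.mk f _) = f`. [folklore] -/
@[simp] lemma G₁.val_mk (f : F) (hf : f.leadingCoeff = 1) : (G₁.mk f hf).val = f := rfl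

/-- Orbit-span lemma: a `G₁`-stable `ℂ`-subspace of `F` containing a non-zero element is
everything. [folklore] -/
lemma span_orbit (P : Submodule ℂ F) (hP : ∀ (u : G₁) (f : F), f ∈ P → u.val * f ∈ P)
    {f : F} (hf : f ∈ P) (hf0 : f ≠ 0) : P = ⊤ := by
  rw [eq_top_iff]
  intro h _
  by_cases hh : h = 0
  · rw [hh]; exact P.zero_mem
  set q : F := h * f⁻¹ with hq
  have hq0 : q ≠ 0 := mul_ne_zero hh (inv_ne_zero hf0)
  set c : ℂ := q.leadingCoeff with hc
  have hc0 : c ≠ 0 := HahnSeries.leadingCoeff_ne_zero.2 hq0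
  set u₀ : F := HahnSeries.C c⁻¹ * q with hu₀
  have hu₀l : u₀.leadingCoeff = 1 := by
    rw [hu₀, HahnSeries.leadingCoeff_mul, HahnSeries.C_apply, HahnSeries.leadingCoeff_of_single,
      ← hc, inv_mul_cancel₀ hc0]
  have hmem := hP (G₁.mk u₀ hu₀l) f hf
  rw [G₁.val_mk] at hmem
  have hcalc : h = HahnSeries.C c * (u₀ * f) := by
    rw [hu₀, hq, mul_assoc (HahnSeries.C c⁻¹), inv_mul_cancel_right₀ hf0, ← mul_assoc, ← map_mul,
      mul_inv_cancel₀ hc0, map_one, one_mul]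
  rw [hcalc, HahnSeries.C_mul_eq_smul]
  exact P.smul_mem c hmem

/-- `F = ℂ((X))` is infinite-dimensional over `ℂ`. [folklore] -/
lemma not_module_finite : ¬ Module.Finite ℂ F := by
  intro h
  have hinj : Function.Injective (HahnSeries.ofFinsuppLinearMap ℂ : (ℤ →₀ ℂ) →ₗ[ℂ] F) := by
    intro f g hfg
    ext a
    have := congrArg (fun x : F => x.coeff a) hfg
    simpa [HahnSeries.coeff_ofFinsuppLinearMap] using this
  have : FiniteDimensional ℂ (ℤ →₀ ℂ) := FiniteDimensional.of_injective _ hinj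
  have := Module.Finite.finite_basis (Finsupp.basisSingleOne : Module.Basis ℤ ℂ (ℤ →₀ ℂ))
  exact not_finite ℤ

/-! ## The group `G₂ = ℤ` with a non-group topology -/

/-- `G₂ = ℤ`, a type synonym (so that it carries our exotic topology and nothing else). [folklore] -/
def G₂ : Type := Multiplicative ℤ

/-- The group structure on `G₂`, inherited from `Multiplicative ℤ`. [folklore] -/
instance : CommGroup G₂ := inferInstanceAs (CommGroup (Multiplicative ℤ))

/-- The integer `n` as an element of `G₂`. [folklore] -/
def z (n : ℤ) : G₂ := Multiplicative.ofAdd n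
/-- The integer underlying `g : G₂`. [folklore] -/
def G₂.toZ (g : G₂) : ℤ := Multiplicative.toAdd (show Multiplicative ℤ from g)

/-- `toZ (z n) = n`. [folklore] -/
@[simp] lemma toZ_z (n : ℤ) : (z n).toZ = n := rfl
/-- `z (toZ g) = g`. [folklore] -/
@[simp] lemma z_toZ (g : G₂) : z g.toZ = g := rfl
/-- `toZ` is additive. [folklore] -/
@[simp] lemma toZ_mul (g h : G₂) : (g * h).toZ = g.toZ + h.toZ := rfl
/-- `toZ 1 = 0`. [folklore] -/
@[simp] lemma toZ_one : (1 : G₂).toZ = 0 := rfl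
/-- `toZ g⁻¹ = - toZ g`. [folklore] -/
@[simp] lemma toZ_inv (g : G₂) : g⁻¹.toZ = -g.toZ := rfl

/-- `z (2k) = (z 2) ^ k`. [folklore] -/
lemma z_two_zpow (k : ℤ) : z (2 * k) = z 2 ^ k := by
  change Multiplicative.ofAdd (2 * k) = Multiplicative.ofAdd (2 : ℤ) ^ k
  rw [← ofAdd_zsmul, smul_eq_mul, mul_comm]

/-- The generating open sets `C k = {n even | -2k ≤ n}`. [folklore] -/
def Cset (k : ℕ) : Set G₂ := {g | Even g.toZ ∧ -(2 * (k : ℤ)) ≤ g.toZ}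
/-- The even integers. [folklore] -/
def E : Set G₂ := {g | Even g.toZ}

/-- The exotic topology `τ₂` on `G₂ = ℤ`: generated by the sets `C k = {n even | -2k ≤ n}`; it is *not* a group topology (translation by `1` is discontinuous). [folklore] -/
instance instTopG₂ : TopologicalSpace G₂ := TopologicalSpace.generateFrom (Set.range Cset)

/-- The generating sets `C k` are open. [folklore] -/
lemma isOpen_Cset (k : ℕ) : IsOpen (Cset k) :=
  TopologicalSpace.isOpen_generateFrom_of_mem ⟨k, rfl⟩

/-- The even integers are the union of the `C k`. [folklore] -/
lemma E_eq : E = ⋃ k, Cset k := by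
  ext g
  simp only [E, Cset, Set.mem_setOf_eq, Set.mem_iUnion]
  constructor
  · intro h
    exact ⟨g.toZ.natAbs, h, by omega⟩
  · rintro ⟨k, h, -⟩
    exact h

/-- The set of even integers is open in `τ₂`. [folklore] -/
lemma isOpen_E : IsOpen E := by
  rw [E_eq]; exact isOpen_iUnion isOpen_Cset

/-- Every open set containing an odd integer is everything. [folklore] -/
lemma open_odd_eq_univ {g : G₂} (hodd : Odd g.toZ) :
    ∀ {s : Set G₂}, IsOpen s → g ∈ s → s = Set.univ := by
  intro s hs
  change TopologicalSpace.GenerateOpen (Set.range Cset) s at hs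
  induction hs with
  | basic t ht =>
    intro hg
    obtain ⟨k, rfl⟩ := ht
    exact absurd hg.1 (Int.not_even_iff_odd.2 hodd)
  | univ => intro; rfl
  | inter t t' _ _ ih ih' =>
    intro hg
    rw [ih hg.1, ih' hg.2, Set.univ_inter]
  | sUnion S _ ih =>
    intro hg
    obtain ⟨t, htS, hgt⟩ := Set.mem_sUnion.1 hg
    exact Set.eq_univ_of_univ_subset ((ih t htS hgt) ▸ Set.subset_sUnion_of_mem htS)

/-- Every open set containing `0` contains `2`. [folklore] -/
lemma open_one_mem : ∀ {s : Set G₂}, IsOpen s → (1 : G₂) ∈ s → z 2 ∈ s := by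
  intro s hs
  change TopologicalSpace.GenerateOpen (Set.range Cset) s at hs
  induction hs with
  | basic t ht =>
    intro _
    obtain ⟨k, rfl⟩ := ht
    simp only [Cset, Set.mem_setOf_eq, toZ_z, even_two, true_and]
    omega
  | univ => intro; trivial
  | inter t t' _ _ ih ih' =>
    intro h1
    exact ⟨ih h1.1, ih' h1.2⟩
  | sUnion S _ ih =>
    intro h1
    obtain ⟨t, htS, h1t⟩ := Set.mem_sUnion.1 h1
    exact Set.mem_sUnion.2 ⟨t, htS, ih t htS h1t⟩

/-- The even integers are not compact (the `C k` cover them with no finite subcover). [folklore] -/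
lemma not_isCompact_E : ¬ IsCompact E := by
  intro hE
  obtain ⟨t, ht⟩ := hE.elim_finite_subcover Cset isOpen_Cset (by rw [E_eq])
  set N : ℕ := t.sup id with hN
  have hmem : z (-(2 * ((N : ℤ) + 1))) ∈ E := by
    simp only [E, Set.mem_setOf_eq, toZ_z, even_neg]
    exact even_two_mul _
  have h := ht hmem
  simp only [Set.mem_iUnion, Cset, Set.mem_setOf_eq, toZ_z, exists_prop] at h
  obtain ⟨k, hk, -, hle⟩ := h
  have hkN : k ≤ N := Finset.le_sup (f := id) hk
  omega

/-- All of `G₂` is compact: the only open set containing an odd integer is everything. [folklore] -/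
lemma isCompact_univ_G₂ : IsCompact (Set.univ : Set G₂) := by
  refine isCompact_of_finite_subcover fun U hUo hU => ?_
  obtain ⟨i, hi⟩ := Set.mem_iUnion.1 (hU (Set.mem_univ (z 1)))
  refine ⟨{i}, ?_⟩
  have : U i = Set.univ := open_odd_eq_univ (by simp) (hUo i) hi
  intro g _
  simp [this]

/-! ## The two-element family and its restricted product -/

/-- The family `G false = G₂`, `G true = G₁`. [folklore] -/
abbrev G (b : Bool) : Type := Bool.rec (motive := fun _ => Type) G₂ G₁ b

/-- Group structures on the family `G`. [folklore] -/
instance instGroupG : (b : Bool) → Group (G b) := fun b =>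
  Bool.rec (motive := fun b => Group (G b)) (inferInstanceAs (Group G₂)) (inferInstanceAs (Group G₁)) b

/-- Topologies on the family `G`: `τ₂` on `G false = G₂`, discrete on `G true = G₁`. [folklore] -/
instance instTopG : (b : Bool) → TopologicalSpace (G b) := fun b =>
  Bool.rec (motive := fun b => TopologicalSpace (G b)) (inferInstanceAs (TopologicalSpace G₂))
    (inferInstanceAs (TopologicalSpace G₁)) b

/-- The compact open subgroups: `K false = ⊤ = ℤ`, `K true = ⊥`. [folklore] -/
def K : (b : Bool) → Subgroup (G b) := fun b =>
  Bool.rec (motive := fun b => Subgroup (G b)) (⊤ : Subgroup G₂) (⊥ : Subgroup G₁) b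

/-- The restricted product `Πʳ b, [G b, K b] ≅ G₁ × G₂`. [folklore] -/
abbrev Grp : Type := Πʳ b, [G b, K b]


/-- Both `K b` are open. [folklore] -/
lemma hK_open : ∀ b, IsOpen ((K b : Subgroup (G b)) : Set (G b)) := by
  intro b; cases b
  · show IsOpen ((⊤ : Subgroup G₂) : Set G₂); simp
  · exact isOpen_discrete _

/-- Both `K b` are compact. [folklore] -/
lemma hK_compact : ∀ b, IsCompact ((K b : Subgroup (G b)) : Set (G b)) := by
  intro b; cases b
  · show IsCompact ((⊤ : Subgroup G₂) : Set G₂); simpa using isCompact_univ_G₂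
  · show IsCompact ((⊥ : Subgroup G₁) : Set G₁); rw [Subgroup.coe_bot]; exact isCompact_singleton

/-- The Gelfand-pair hypothesis of `flath_exists` is vacuous over the finite index type `Bool` (`cofinite = ⊥`). [folklore] -/
lemma hGP : ∀ᶠ b in cofinite, IsGelfandPair ℂ (G b) (K b) := by
  rw [Filter.cofinite_eq_bot]; exact Filter.eventually_bot

/-! ## The representation `π (u, n) f = (-1)ⁿ u f` of `Grp` on `F` -/

/-- The scalar by which `x : Grp` acts. [folklore] -/
def s (x : Grp) : F := (-1 : F) ^ (G₂.toZ (x false)) * G₁.val (x true)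

/-- `s 1 = 1`. [folklore] -/
lemma s_one : s 1 = 1 := by
  have h1 : G₂.toZ ((1 : Grp) false) = 0 := rfl
  have h2 : G₁.val ((1 : Grp) true) = 1 := rfl
  rw [s, h1, h2, zpow_zero, one_mul]

/-- `s` is multiplicative. [folklore] -/
lemma s_mul (x y : Grp) : s (x * y) = s x * s y := by
  have h1 : G₂.toZ ((x * y) false) = G₂.toZ (x false) + G₂.toZ (y false) := rfl
  have h2 : G₁.val ((x * y) true) = G₁.val (x true) * G₁.val (y true) := rfl
  simp only [s, h1, h2, zpow_add₀ (show (-1 : F) ≠ 0 by norm_num)]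
  ring

/-- Left multiplication by `a`, as a `ℂ`-linear map (for the coefficientwise `ℂ`-module
structure of `HahnSeries`). [folklore] -/
def mulL (a : F) : F →ₗ[ℂ] F where
  toFun f := a * f
  map_add' := mul_add a
  map_smul' c f := by
    simp only [RingHom.id_apply]
    rw [← HahnSeries.C_mul_eq_smul, ← HahnSeries.C_mul_eq_smul]
    ring

/-- `mulL a f = a * f`. [folklore] -/
@[simp] lemma mulL_apply (a f : F) : mulL a f = a * f := rfl

/-- The representation. [folklore] -/
def π : Representation ℂ Grp F where
  toFun x := mulL (s x)
  map_one' := by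
    refine LinearMap.ext fun f => ?_
    show s 1 * f = f
    rw [s_one, one_mul]
  map_mul' x y := by
    refine LinearMap.ext fun f => ?_
    show s (x * y) * f = s x * (s y * f)
    rw [s_mul, mul_assoc]

/-- `π x f = s x * f`. [folklore] -/
@[simp] lemma π_apply (x : Grp) (f : F) : π x f = s x * f := rfl

/-- `s (u, 0) = u`. [folklore] -/
lemma s_single_true (u : G₁) : s (RestrictedProduct.mulSingle K true u) = u.val := by
  have h1 : G₂.toZ ((RestrictedProduct.mulSingle K true u : Grp) false) = 0 := rfl
  have h2 : G₁.val ((RestrictedProduct.mulSingle K true u : Grp) true) = u.val := rfl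
  rw [s, h1, h2, zpow_zero, one_mul]

/-- `s (1, n) = (-1) ^ n`. [folklore] -/
lemma s_single_false (n : G₂) : s (RestrictedProduct.mulSingle K false n) = (-1 : F) ^ n.toZ := by
  have h1 : G₂.toZ ((RestrictedProduct.mulSingle K false n : Grp) false) = n.toZ := rfl
  have h2 : G₁.val ((RestrictedProduct.mulSingle K false n : Grp) true) = 1 := rfl
  rw [s, h1, h2, mul_one]

/-- `(-1 : F) ^ k` is the constant series `(-1) ^ k`. [folklore] -/
lemma neg_one_zpow_F (k : ℤ) : ((-1 : F) ^ k) = HahnSeries.C ((-1 : ℂ) ^ k) := by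
  rw [map_zpow₀, map_neg, map_one]

/-- `(-1)ⁿ u = 1` in `F` iff `u = 1` and `n` is even (compare leading coefficients). [folklore] -/
lemma s_eq_one_iff (u : G₁) (n : G₂) : (-1 : F) ^ n.toZ * u.val = 1 ↔ u = 1 ∧ Even n.toZ := by
  constructor
  · intro h
    have hl := congrArg HahnSeries.leadingCoeff h
    rw [HahnSeries.leadingCoeff_mul, G₁.leadingCoeff_val, mul_one, HahnSeries.leadingCoeff_one,
      neg_one_zpow_F, HahnSeries.C_apply, HahnSeries.leadingCoeff_of_single] at hl
    have he : Even n.toZ := by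
      by_contra hne
      rw [Int.not_even_iff_odd] at hne
      rw [hne.neg_one_zpow] at hl
      norm_num at hl
    refine ⟨?_, he⟩
    rw [neg_one_zpow_F, he.neg_one_zpow, map_one, one_mul, G₁.val_eq_one] at h
    exact h
  · rintro ⟨rfl, he⟩
    rw [neg_one_zpow_F, he.neg_one_zpow, map_one, one_mul, G₁.val_one]

/-! ### Smoothness -/

/-- The stabiliser of a non-zero `f` is exactly `{1} × 2ℤ`. [folklore] -/
lemma stabilizer_eq {f : F} (hf : f ≠ 0) :
    ((π.stabilizerSubgroup f : Subgroup Grp) : Set Grp) =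
      (fun x : Grp => (x true : G₁)) ⁻¹' {1} ∩ (fun x : Grp => (x false : G₂)) ⁻¹' E := by
  ext x
  rw [SetLike.mem_coe, Representation.mem_stabilizerSubgroup, π_apply, mul_eq_right₀ hf]
  exact s_eq_one_iff (x true) (x false)

/-- `π` is smooth: stabilisers are `{1} × 2ℤ` (or everything), open in the product of the discrete topology and `τ₂`. [folklore] -/
lemma π_isSmooth : π.IsSmooth := by
  intro f
  by_cases hf : f = 0
  · subst hf
    simp [Representation.IsSmoothVector]
  · rw [Representation.IsSmoothVector, stabilizer_eq hf]
    exact ((isOpen_discrete _).preimage (RestrictedProduct.continuous_eval true)).inter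
      (isOpen_E.preimage (RestrictedProduct.continuous_eval false))

/-! ### Continuity of maps into `Grp` (finite index set) -/

/-- Over `Bool` the restricted-product membership condition is vacuous. [folklore] -/
lemma ev_cof (g : (b : Bool) → G b) : ∀ᶠ b in cofinite, g b ∈ (K b : Set (G b)) :=
  Filter.eventually_cofinite.2 (Set.toFinite _)

/-- Over a finite index type, a map into the restricted product is continuous as soon as its coordinates are (it factors through the principal piece `Πʳ_[𝓟 ∅]`, which carries the product topology). [folklore] -/
lemma continuous_toGrp {X : Type} [TopologicalSpace X] {f : X → (b : Bool) → G b}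
    (hf : Continuous f) :
    Continuous fun x => (RestrictedProduct.mk (f x) (ev_cof (f x)) : Grp) := by
  have h0 : (cofinite : Filter Bool) ≤ 𝓟 (∅ : Set Bool) := by
    rw [Filter.le_principal_iff, Filter.mem_cofinite, Set.compl_empty]; exact Set.finite_univ
  have hin : Continuous fun x =>
      (RestrictedProduct.mk (f x) (by simp) : Πʳ b, [G b, K b]_[𝓟 (∅ : Set Bool)]) :=
    (RestrictedProduct.continuous_rng_of_principal
      (f := fun x => (RestrictedProduct.mk (f x) (by simp) : Πʳ b, [G b, K b]_[𝓟 (∅ : Set Bool)]))).2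
      hf
  exact (RestrictedProduct.continuous_inclusion h0).comp hin

/-- `(1, n)` as an explicit restricted-product element. [folklore] -/
lemma single_false_eq (n : G₂) : (RestrictedProduct.mulSingle K false n : Grp) =
    RestrictedProduct.mk (fun b => Bool.rec (motive := fun b => G b) n (1 : G₁) b) (ev_cof _) := by
  ext b; cases b <;> rfl

/-- `n ↦ (1, n)` is continuous. [folklore] -/
lemma continuous_single_false :
    Continuous fun n : G₂ => (RestrictedProduct.mulSingle K false n : Grp) := by
  have heq : (fun n : G₂ => (RestrictedProduct.mulSingle K false n : Grp)) = fun n =>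
      RestrictedProduct.mk (fun b => Bool.rec (motive := fun b => G b) n (1 : G₁) b) (ev_cof _) :=
    funext single_false_eq
  rw [heq]
  apply continuous_toGrp
  exact continuous_pi fun b => by
    cases b
    · exact continuous_id
    · exact continuous_const

/-- `(u, n)` as an explicit restricted-product element. [folklore] -/
lemma pair_eq (u : G₁) (n : G₂) :
    (RestrictedProduct.mulSingle K true u * RestrictedProduct.mulSingle K false n : Grp) =
      RestrictedProduct.mk (fun b => Bool.rec (motive := fun b => G b) n u b) (ev_cof _) := by
  ext b; cases b
  · show (1 : G₂) * n = n; exact one_mul n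
  · show u * (1 : G₁) = u; exact mul_one u

/-- `n ↦ (u, n)` is continuous for every fixed `u`. [folklore] -/
lemma continuous_pair (u : G₁) : Continuous fun n : G₂ =>
    (RestrictedProduct.mulSingle K true u * RestrictedProduct.mulSingle K false n : Grp) := by
  have heq : (fun n : G₂ =>
      (RestrictedProduct.mulSingle K true u * RestrictedProduct.mulSingle K false n : Grp)) = fun n =>
        RestrictedProduct.mk (fun b => Bool.rec (motive := fun b => G b) n u b) (ev_cof _) :=
    funext (pair_eq u)
  rw [heq]
  apply continuous_toGrp
  exact continuous_pi fun b => by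
    cases b
    · exact continuous_id
    · exact continuous_const

/-! ### Admissibility: every compact open subgroup contains `(1, 1)`, which acts by `-1` -/

/-- **Key lemma.** Every compact open subgroup `K'` of `G₁ × G₂` contains `(1, 1)`: openness at the identity gives `(1, 2ℤ) ⊆ K'`; compactness of the projection of `K'` to `G₂` (where `2ℤ` is not compact) forces an element `(u, m)` with `m` odd; openness at `(u, m)` along `n ↦ (u, n)` (the only open set containing an odd integer is everything) gives `(u, m + 1) ∈ K'`, hence `(1, 1) ∈ K'`. [folklore] -/
lemma single_false_mem (K' : OpenSubgroup Grp) (hK : IsCompact (K' : Set Grp)) :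
    (RestrictedProduct.mulSingle K false (z 1) : Grp) ∈ K' := by
  have hopen : IsOpen (K' : Set Grp) := K'.isOpen
  have h2 : (RestrictedProduct.mulSingle K false (z 2) : Grp) ∈ K' := by
    have ho := hopen.preimage continuous_single_false
    have h1 : (1 : G₂) ∈
        (fun n : G₂ => (RestrictedProduct.mulSingle K false n : Grp)) ⁻¹' (K' : Set Grp) := by
      simp only [Set.mem_preimage, RestrictedProduct.mulSingle_one, SetLike.mem_coe]
      exact K'.one_mem
    exact open_one_mem ho h1
  have heven : ∀ n : ℤ, Even n → (RestrictedProduct.mulSingle K false (z n) : Grp) ∈ K' := by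
    rintro n ⟨k, rfl⟩
    rw [← two_mul, z_two_zpow, RestrictedProduct.mulSingle_zpow]
    exact zpow_mem h2 k
  obtain ⟨x, hx, hxodd⟩ : ∃ x ∈ (K' : Set Grp), Odd (G₂.toZ (x false)) := by
    by_contra hall
    push Not at hall
    apply not_isCompact_E
    have hA : IsCompact ((fun x : Grp => (x false : G₂)) '' (K' : Set Grp)) :=
      hK.image (RestrictedProduct.continuous_eval false)
    convert hA using 1
    ext n
    simp only [E, Set.mem_setOf_eq, Set.mem_image]
    constructor
    · intro hn
      exact ⟨_, heven n.toZ hn, rfl⟩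
    · rintro ⟨x, hx, rfl⟩
      exact Int.not_odd_iff_even.1 (hall x hx)
  have ho2 := hopen.preimage (continuous_pair (x true))
  have hxe : RestrictedProduct.mulSingle K true (x true) * RestrictedProduct.mulSingle K false (x false)
      = x := by
    ext b; cases b <;> simp [RestrictedProduct.mul_apply]
  have hxpre : (x false : G₂) ∈ (fun n : G₂ =>
      (RestrictedProduct.mulSingle K true (x true) * RestrictedProduct.mulSingle K false n : Grp)) ⁻¹'
        (K' : Set Grp) := by
    simp only [Set.mem_preimage, hxe]
    exact hx
  have huniv := open_odd_eq_univ hxodd ho2 hxpre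
  have hy : (x false * z 1 : G₂) ∈ (fun n : G₂ =>
      (RestrictedProduct.mulSingle K true (x true) * RestrictedProduct.mulSingle K false n : Grp)) ⁻¹'
        (K' : Set Grp) := by
    rw [huniv]; trivial
  have hcalc : x⁻¹ * (RestrictedProduct.mulSingle K true (x true) *
      RestrictedProduct.mulSingle K false (x false * z 1)) = RestrictedProduct.mulSingle K false (z 1) := by
    ext b; cases b <;> simp [RestrictedProduct.mul_apply, RestrictedProduct.inv_apply]
  rw [← hcalc]
  exact mul_mem (inv_mem hx) hy

/-- `π` is admissible: it is smooth, and for every compact open `K'` the `K'`-fixed vectors vanish because `(1, 1) ∈ K'` acts by `-1`. [folklore] -/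
lemma π_isAdmissible : π.IsAdmissible := by
  refine ⟨π_isSmooth, fun K' hK' => ?_⟩
  have hmem := single_false_mem K' hK'
  have hbot : π.fixedPoints (K' : Subgroup Grp) = ⊥ := by
    rw [eq_bot_iff]
    intro f hf
    have h := (π.mem_fixedPoints _ f).1 hf _ hmem
    rw [π_apply, s_single_false, toZ_z, neg_one_zpow_F, zpow_one, HahnSeries.C_mul_eq_smul] at h
    -- h : (-1 : ℂ) • f = f
    rw [Submodule.mem_bot]
    ext a
    have ha := congrArg (fun g : F => g.coeff a) h
    simp only [HahnSeries.coeff_smul, smul_eq_mul] at ha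
    simp only [HahnSeries.coeff_zero]
    linear_combination (-(1 : ℂ) / 2) * ha
  rw [hbot]
  infer_instance

/-! ### Irreducibility -/

/-- `π` is irreducible (the `ℂ`-span of the `G₁`-orbit of any non-zero Laurent series is everything). [folklore] -/
lemma π_isIrreducible : π.IsIrreducible := by
  haveI : Nontrivial (Subrepresentation π) := ⟨⟨⊥, ⊤, fun h => by
    have h' := congrArg Subrepresentation.toSubmodule h
    change (⊥ : Submodule ℂ F) = ⊤ at h'
    have h1 : (1 : F) ∈ (⊥ : Submodule ℂ F) := by rw [h']; trivial
    exact one_ne_zero ((Submodule.mem_bot ℂ).1 h1)⟩⟩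
  refine ⟨fun p => ?_⟩
  by_cases hex : ∃ f ∈ p.toSubmodule, f ≠ 0
  · obtain ⟨f, hf, hf0⟩ := hex
    right
    apply Subrepresentation.toSubmodule_injective
    change p.toSubmodule = ⊤
    refine span_orbit p.toSubmodule (fun u g hg => ?_) hf hf0
    have := p.apply_mem_toSubmodule (RestrictedProduct.mulSingle K true u) hg
    rwa [π_apply, s_single_true] at this
  · left
    push Not at hex
    apply Subrepresentation.toSubmodule_injective
    change p.toSubmodule = ⊥
    exact (Submodule.eq_bot_iff _).2 hex

/-! ## The refutation -/

/-- **The universal closure of `flath_exists` (as actually declared) is false**, already at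
universe level `0`: instantiate at the two-element family above. [folklore] -/
theorem not_flath_exists_closure :
    ¬ ∀ {ι : Type} [DecidableEq ι] {G : ι → Type} [∀ i, Group (G i)] [∀ i, TopologicalSpace (G i)]
        {K : ∀ i, Subgroup (G i)} {W : Type} [AddCommGroup W] [Module ℂ W],
        Literature.NumberTheory.Automorphic.flath_exists (ι := ι) (G := G) (K := K) (W := W) := by
  intro H
  have H1 := @H Bool _ G instGroupG instTopG K F _ _
  obtain ⟨V, instV, instM, ρ, x₀, hx₀, j, S₀, hRTP, hloc, -⟩ :=
    H1 hK_open hK_compact hGP π π_isIrreducible π_isAdmissible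
  -- (1) `V true` is finite-dimensional: `ρ true` is admissible for the *discrete* group `G₁`.
  have hfinV : Module.Finite ℂ (V true) := by
    have hadm := (hloc true).2
    let Kb : OpenSubgroup (G true) := ⟨⊥, isOpen_discrete _⟩
    have hc : IsCompact (Kb : Set (G true)) := by
      show IsCompact (((⊥ : Subgroup (G true)) : Set (G true)))
      rw [Subgroup.coe_bot]
      exact isCompact_singleton
    have hfin := hadm.2 Kb hc
    have htop : (ρ true).fixedPoints (Kb : Subgroup (G true)) = ⊤ := by
      ext v
      simp only [Submodule.mem_top, iff_true, Representation.mem_fixedPoints]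
      intro g hg
      have hg1 : g = 1 := Subgroup.mem_bot.1 hg
      subst hg1
      simp
    rw [htop] at hfin
    exact Module.Finite.of_surjective (hM := hfin) (⊤ : Submodule ℂ (V true)).subtype
      (fun v => ⟨⟨v, trivial⟩, rfl⟩)
  -- (2) unpack the restricted tensor product structure
  obtain ⟨hj, -, hsup⟩ := hRTP.1
  have heqv := hRTP.2
  -- (3) `j` is not identically zero (the ranges of the `liftFinset S` exhaust `W = F ≠ 0`)
  obtain ⟨xr, hxr⟩ : ∃ xr, j xr ≠ 0 := by
    by_contra hall
    push Not at hall
    have hle : (⊤ : Submodule ℂ F) ≤ ⊥ := by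
      rw [← hsup]
      refine iSup_le fun S => ?_
      rintro _ ⟨t, rfl⟩
      induction t using PiTensorProduct.induction_on with
      | smul_tprod r m =>
        rw [map_smul, IsRestrictedMultilinear.liftFinset_tprod, hall, smul_zero]
        exact Submodule.zero_mem _
      | add a b ha hb =>
        rw [map_add]
        exact Submodule.add_mem _ ha hb
    exact one_ne_zero ((Submodule.mem_bot ℂ).1 (hle (Submodule.mem_top : (1 : F) ∈ ⊤)))
  -- (4) the `G₁`-equivariant linear map `Φ : V true → F`, `v ↦ j (xr with v in slot true)`
  let Φ : V true →ₗ[ℂ] F :=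
    { toFun := fun v => j (xr.update true v)
      map_add' := fun v w => hj.map_update_add xr true v w
      map_smul' := fun c v => hj.map_update_smul xr true c v }
  have hΦ : ∀ (u : G₁) (v : V true), Φ ((ρ true) u v) = u.val * Φ v := by
    intro u v
    have hfam : RestrictedFamily.smul ρ hx₀ (RestrictedProduct.mulSingle K true u) (xr.update true v)
        = xr.update true ((ρ true) u v) := by
      ext b
      cases b
      · simp [RestrictedFamily.smul_apply]
      · simp [RestrictedFamily.smul_apply]
    have h := heqv (RestrictedProduct.mulSingle K true u) (xr.update true v)
    rw [hfam, π_apply, s_single_true] at h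
    exact h
  have hΦxr : Φ (xr true) = j xr := by
    show j (xr.update true (xr true)) = j xr
    congr 1
    ext b
    simp
  -- (5) `range Φ` is a non-zero finite-dimensional `G₁`-stable subspace of `F`, hence all of `F`
  have hP : LinearMap.range Φ = ⊤ :=
    span_orbit (LinearMap.range Φ) (fun u f hf => by
      obtain ⟨v, rfl⟩ := hf
      exact ⟨(ρ true) u v, hΦ u v⟩) ⟨xr true, hΦxr⟩ hxr
  have hfinR : Module.Finite ℂ (LinearMap.range Φ) := inferInstance
  rw [hP] at hfinR
  exact not_module_finite (Module.Finite.of_surjective (hM := hfinR) (⊤ : Submodule ℂ F).subtype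
    (fun f => ⟨⟨f, trivial⟩, rfl⟩))

end FlathCex

/-- **`flath_exists` is false as declared** (cone audit 2026-08-15, refuted-misstated): the `def` silently dropped the section's locally-profinite instance binders, so its closure ranges over arbitrarily topologised groups, and the two-element family `FlathCex.G` (discrete `G₁ ≤ ℂ((X))ˣ`, `ℤ` with a non-group topology) with the irreducible admissible representation `FlathCex.π` on `ℂ((X))` admits no restricted-tensor-product factorisation into irreducible *admissible* factors (the `G₁`-factor would be finite-dimensional, but `ℂ((X))` has no non-zero finite-dimensional `G₁`-stable subspace). Repair: restate `flath_exists` with `∀ [∀ i, IsTopologicalGroup (G i)]` (or the locally-profinite mixins) as explicit binders in the body; this witness is not a topological group and does not refute the repaired statement. [folklore] -/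
theorem not_flath_exists :
    ¬ ∀ {ι : Type} [DecidableEq ι] {G : ι → Type} [∀ i, Group (G i)] [∀ i, TopologicalSpace (G i)]
        {K : ∀ i, Subgroup (G i)} {W : Type} [AddCommGroup W] [Module ℂ W],
        Literature.NumberTheory.Automorphic.flath_exists (ι := ι) (G := G) (K := K) (W := W) :=
  FlathCex.not_flath_exists_closure

end Literature.NumberTheory.Automorphic
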